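import Summits.AtomisticToContinuum.Crystallization.Theorems.FrustratedLawDichotomyThickeningVacancyFloor
import Literature.Probability.Process.PointStationaryTransfer

/-!
# FrustratedLawDichotomy · crux `AperiodicFrustratedLawGap` (stmt-AtomisticToContinuum-27623) — THE BINDING FLOOR OF A MINIMISING LAW
# (pointwise form of THINNING STABILITY; dual of the vacancy floor of `FrustratedLawDichotomyThickeningVacancyFloor`)
# (decomp-a2c, prover hand 2, structural share, generation 4)

`FrustratedLawDichotomyThinning.thinning_stability` (generation 2) says that deleting a covariantly selected family of atoms never lowers the mean
energy of a point-stationary hard-core law below `e⋆`.  Here it is made SYMMETRIC and POINTWISE, exactly as the insertion side in parts 3–4: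

* `integral_deletedField_eq` — the Mecke swap for deletions: for a Giry-measurable DELETION PATTERN `D`,
  `∫_{Dᶜ} Σ_{y : θ_y μ ∈ D} V_LJ(‖y‖) dP = ∫_D Σ_{y : θ_y μ ∉ D} V_LJ(‖y‖) dP` (a kept root's bonds to deleted atoms have the same mean as a deleted
  root's bonds to kept atoms);
* `bindingPrice_of_minimising` — for a MINIMISING law (`E_P[rootEnergy] ≤ e⋆`, granted the floor of item 9229) and every measurable `D`:
  `∫_D (rootEnergy μ + ½ Σ_{y : θ_y μ ∉ D} V_LJ(‖y‖)) dP ≤ P(D)·e⋆` — conditionally on the deletion pattern, the deleted root's bonds to the kept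
  atoms plus half its bonds to the other deleted atoms average AT MOST `e⋆`;
* `bindingFloor_of_minimising` — **POINTWISE BINDING FLOOR**: almost surely `2·rootEnergy μ ≤ e⋆ + ½ Σ_{y} V_LJ⁺(‖y‖)`: the root's one-particle
  energy `h = Σ_{y≠0} V_LJ(‖y‖)` is at most `e⋆ ≈ −0.7175` up to half its short-range repulsion (pattern `D = {2 rootEnergy − ½R > e⋆}`);
  `ae_forall_bindingFloor_of_minimising` — the same at EVERY atom (Aldous–Lyons transfer).

With the vacancy floor this brackets minimisers from both sides: every ATOM is bound by at least `|e⋆|` and every HOLE binds by at most `|e⋆|`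
(each up to half the local short-range repulsion) — Sütő's one-atom deletion / insertion tests of an `e⋆`-μGSC, law level and pointwise.
All `[folklore]`.
-/

noncomputable section

namespace Summit.AtomisticToContinuum.Crystallization.Theorems.FrustratedLawDichotomyBindingFloor

open MeasureTheory Metric Set Filter ProbabilityTheory
open scoped ENNReal Topology BigOperators
open Literature.MathematicalPhysics.StatisticalMechanics Literature.Probability.Process
open Summit.AtomisticToContinuum.Crystallization.Theorems.ChargedEnergyGapNegative (E3 eStar)
open Summit.AtomisticToContinuum.Crystallization.Theorems.FrustratedLawDichotomyFiniteClusterGap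
  (ae_mem_of_sep exists_kernel_eq_count_restrict measurable_kernel_map_sub measurable_ofReal_lennardJones_parts
    lintegral_lennardJones_parts_map_sub_le integrable_rootEnergy_of_ae_hardCore)
open Summit.AtomisticToContinuum.Crystallization.Theorems.FrustratedLawDichotomyThinning
  (exists_measurable_thinning thinning_stability map_sub_map_sub_neg)
open Summit.AtomisticToContinuum.Crystallization.Theorems.FrustratedLawDichotomyThickening
  (integrable_lennardJones_of_hardCore ae_shellFinite_of_hardCore)
open Summit.AtomisticToContinuum.Crystallization.Theorems.FrustratedLawDichotomyTransportPrice (integral_inflow_toReal_eq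
  lintegral_outflow_ne_top_of_bound)

variable {δ : ℝ} {D : Set (Measure E3)} {P : Measure (Measure E3)}

/-! ## §1. Energy of a thinned configuration -/

/-- **Root energy after deleting the `D`-pattern atoms**: `rootEnergy(μ|{y : θ_y μ ∉ D}) = rootEnergy μ − ½ ∫ V_LJ(‖y‖) d(μ|{y : θ_y μ ∈ D})`, and
both restricted Lennard-Jones sums are integrable (hard core). [folklore] -/
theorem rootEnergy_thin (hδ : 0 < δ) {μ : Measure E3} (hμ : IsRootedHardCore δ μ)
    (hK : MeasurableSet {y : E3 | μ.map (fun x : E3 => x - y) ∈ D}) :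
    Integrable (fun z : E3 => lennardJones ‖z‖) (μ.restrict {y : E3 | μ.map (fun x : E3 => x - y) ∈ D}) ∧
    Integrable (fun z : E3 => lennardJones ‖z‖) (μ.restrict {y : E3 | μ.map (fun x : E3 => x - y) ∈ D}ᶜ) ∧
    rootEnergy lennardJones (μ.restrict {y : E3 | μ.map (fun x : E3 => x - y) ∈ D}ᶜ) =
      rootEnergy lennardJones μ - (∫ z, lennardJones ‖z‖ ∂(μ.restrict {y : E3 | μ.map (fun x : E3 => x - y) ∈ D})) / 2 := by
  have hint := integrable_lennardJones_of_hardCore hδ hμ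
  have h1 : Integrable (fun z : E3 => lennardJones ‖z‖) (μ.restrict {y : E3 | μ.map (fun x : E3 => x - y) ∈ D}) :=
    hint.mono_measure Measure.restrict_le_self
  have h2 : Integrable (fun z : E3 => lennardJones ‖z‖) (μ.restrict {y : E3 | μ.map (fun x : E3 => x - y) ∈ D}ᶜ) :=
    hint.mono_measure Measure.restrict_le_self
  refine ⟨h1, h2, ?_⟩
  have hsplit : ∫ z, lennardJones ‖z‖ ∂μ = (∫ z, lennardJones ‖z‖ ∂(μ.restrict {y : E3 | μ.map (fun x : E3 => x - y) ∈ D})) +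
      ∫ z, lennardJones ‖z‖ ∂(μ.restrict {y : E3 | μ.map (fun x : E3 => x - y) ∈ D}ᶜ) := by
    rw [← integral_add_measure h1 h2, Measure.restrict_add_restrict_compl hK]
  rw [rootEnergy_def, rootEnergy_def, hsplit]
  ring

/-! ## §2. The Mecke swap for deletions -/

/-- **A KEPT ROOT'S BONDS TO DELETED ATOMS AND A DELETED ROOT'S BONDS TO KEPT ATOMS HAVE THE SAME MEAN.**  For a point-stationary `δ`-hard-core
probability law and a Giry-measurable deletion pattern `D`:
`∫_{Dᶜ} ∫ V_LJ(‖y‖) d(μ|{θ_y μ ∈ D}) dP = ∫_D ∫ V_LJ(‖y‖) d(μ|{θ_y μ ∉ D}) dP`, both integrands being integrable on their events. [folklore] -/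
theorem integral_deletedField_eq (hδ : 0 < δ) [IsProbabilityMeasure P] (hcore : ∀ᵐ μ ∂P, IsRootedHardCore δ μ)
    (hstat : IsPointStationaryLaw P) (hD : MeasurableSet D) :
    Integrable (fun μ => Dᶜ.indicator (fun μ => ∫ z, lennardJones ‖z‖ ∂(μ.restrict {y : E3 | μ.map (fun x : E3 => x - y) ∈ D})) μ) P ∧
    Integrable (fun μ => D.indicator (fun μ => ∫ z, lennardJones ‖z‖ ∂(μ.restrict {y : E3 | μ.map (fun x : E3 => x - y) ∈ D}ᶜ)) μ) P ∧
    ∫ μ in Dᶜ, ∫ z, lennardJones ‖z‖ ∂(μ.restrict {y : E3 | μ.map (fun x : E3 => x - y) ∈ D}) ∂P =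
      ∫ μ in D, ∫ z, lennardJones ‖z‖ ∂(μ.restrict {y : E3 | μ.map (fun x : E3 => x - y) ∈ D}ᶜ) ∂P := by
  classical
  obtain ⟨T, hTm, hT⟩ := exists_measurable_thinning (G := D) hδ hD
  -- kernelised pattern relation
  obtain ⟨κ, hκs, hκ⟩ := exists_kernel_eq_count_restrict hδ
  have hκid : ∀ μ : Measure E3, IsRootedHardCore δ μ → κ μ = μ := by
    rintro μ ⟨S, -, hsep, rfl⟩; exact hκ S hsep
  set B : Set (Measure E3 × E3) := (fun q : Measure E3 × E3 => (κ q.1).map fun z => z - q.2) ⁻¹' D with hBdef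
  have hB : MeasurableSet B := measurable_kernel_map_sub κ hD
  have hsec : ∀ μ : Measure E3, IsRootedHardCore δ μ → ∀ y : E3,
      ((μ, y) ∈ B ↔ y ∈ {y : E3 | μ.map (fun x : E3 => x - y) ∈ D}) := fun μ hμ y => by
    simp only [hBdef, Set.mem_preimage, Set.mem_setOf_eq, hκid μ hμ]
  obtain ⟨hp, hm⟩ := measurable_ofReal_lennardJones_parts
  -- transports: a KEPT root (`μ ∉ D`) sends `V_LJ^±(‖y‖)` to each DELETED atom `y` (`θ_y μ ∈ D`)
  set Fp : Measure E3 → E3 → ℝ≥0∞ := fun μ y =>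
    Dᶜ.indicator (fun _ => (1 : ℝ≥0∞)) μ * (B.indicator (fun _ => (1 : ℝ≥0∞)) (μ, y) * ENNReal.ofReal (lennardJones ‖y‖)) with hFp
  set Fm : Measure E3 → E3 → ℝ≥0∞ := fun μ y =>
    Dᶜ.indicator (fun _ => (1 : ℝ≥0∞)) μ * (B.indicator (fun _ => (1 : ℝ≥0∞)) (μ, y) * ENNReal.ofReal (-lennardJones ‖y‖)) with hFm
  have h1D : Measurable fun q : Measure E3 × E3 => Dᶜ.indicator (fun _ => (1 : ℝ≥0∞)) q.1 :=
    (measurable_const.indicator hD.compl).comp measurable_fst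
  have h1B : Measurable fun q : Measure E3 × E3 => B.indicator (fun _ => (1 : ℝ≥0∞)) q := measurable_const.indicator hB
  have hFpm : Measurable (Function.uncurry Fp) := h1D.mul (h1B.mul (hp.comp measurable_snd))
  have hFmm : Measurable (Function.uncurry Fm) := h1D.mul (h1B.mul (hm.comp measurable_snd))
  -- out-flows on hard-core configurations
  have hout : ∀ μ : Measure E3, IsRootedHardCore δ μ → ∀ (f : E3 → ℝ≥0∞), Measurable f →
      ∫⁻ y, Dᶜ.indicator (fun _ => (1 : ℝ≥0∞)) μ * (B.indicator (fun _ => (1 : ℝ≥0∞)) (μ, y) * f y) ∂μ =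
        Dᶜ.indicator (fun _ => (1 : ℝ≥0∞)) μ * ∫⁻ y, f y ∂(μ.restrict {y : E3 | μ.map (fun x : E3 => x - y) ∈ D}) := by
    intro μ hμ f hf
    rw [lintegral_const_mul _ (show Measurable (fun y : E3 => B.indicator (fun _ => (1 : ℝ≥0∞)) (μ, y) * f y) from
      ((measurable_const.indicator hB).comp measurable_prodMk_left).mul hf), ← lintegral_indicator (hT μ hμ).1]
    congr 1
    refine lintegral_congr fun y => ?_
    by_cases hy : y ∈ {y : E3 | μ.map (fun x : E3 => x - y) ∈ D}
    · rw [Set.indicator_of_mem ((hsec μ hμ y).2 hy), Set.indicator_of_mem hy, one_mul]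
    · rw [Set.indicator_of_notMem (fun h => hy ((hsec μ hμ y).1 h)), Set.indicator_of_notMem hy, zero_mul]
  -- in-flows on hard-core configurations
  have hin : ∀ μ : Measure E3, IsRootedHardCore δ μ → ∀ (f : E3 → ℝ≥0∞), Measurable f →
      ∫⁻ y, Dᶜ.indicator (fun _ => (1 : ℝ≥0∞)) (μ.map fun z => z - y) *
          (B.indicator (fun _ => (1 : ℝ≥0∞)) (μ.map (fun z => z - y), -y) * f (-y)) ∂μ =
        D.indicator (fun _ => (1 : ℝ≥0∞)) μ * ∫⁻ y, f (-y) ∂(μ.restrict {y : E3 | μ.map (fun x : E3 => x - y) ∈ D}ᶜ) := by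
    intro μ hμ f hf
    have hμ' := hμ
    have hKc : MeasurableSet {y : E3 | μ.map (fun x : E3 => x - y) ∈ D}ᶜ := (hT μ hμ).1.compl
    rw [← lintegral_const_mul _ (show Measurable (fun y : E3 => f (-y)) from hf.comp measurable_neg), ← lintegral_indicator hKc]
    obtain ⟨S, h0S, hsep, rfl⟩ := hμ
    refine lintegral_congr_ae ((ae_mem_of_sep hδ hsep).mono fun y hy => ?_)
    have hy' : (Measure.count : Measure E3).restrict S {y} ≠ 0 := (count_restrict_singleton_ne_zero_iff S y).2 hy
    have hmem : ((((Measure.count : Measure E3).restrict S).map fun z : E3 => z - y), -y) ∈ B ↔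
        (Measure.count : Measure E3).restrict S ∈ D := by
      rw [hsec _ (hμ'.map_sub hy') (-y), Set.mem_setOf_eq, map_sub_map_sub_neg]
    dsimp only
    by_cases hyK : ((Measure.count : Measure E3).restrict S).map (fun x : E3 => x - y) ∈ D
    · -- `y` is a deleted atom: it sends nothing
      have : y ∉ {y : E3 | ((Measure.count : Measure E3).restrict S).map (fun x : E3 => x - y) ∈ D}ᶜ := fun h => h hyK
      have hnot : ((Measure.count : Measure E3).restrict S).map (fun x : E3 => x - y) ∉ Dᶜ := fun h => h hyK
      simp only [Set.indicator_of_notMem hnot, zero_mul, Set.indicator_of_notMem this]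
    · have hyKc : y ∈ {y : E3 | ((Measure.count : Measure E3).restrict S).map (fun x : E3 => x - y) ∈ D}ᶜ := hyK
      have hin' : ((Measure.count : Measure E3).restrict S).map (fun x : E3 => x - y) ∈ Dᶜ := hyK
      simp only [Set.indicator_of_mem hin', one_mul, Set.indicator_of_mem hyKc]
      by_cases h : (Measure.count : Measure E3).restrict S ∈ D
      · rw [Set.indicator_of_mem (hmem.2 h), Set.indicator_of_mem h]
      · rw [Set.indicator_of_notMem (fun h' => h (hmem.1 h')), Set.indicator_of_notMem h]
  -- finite mean out-flows (shell bounds at the root)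
  have hbd : ∀ μ : Measure E3, IsRootedHardCore δ μ →
      (∫⁻ y, ENNReal.ofReal (lennardJones ‖y‖) ∂(μ.restrict {y : E3 | μ.map (fun x : E3 => x - y) ∈ D}) ≤ ENNReal.ofReal (250 / 12 * δ⁻¹ ^ 12)) ∧
      (∫⁻ y, ENNReal.ofReal (-lennardJones ‖y‖) ∂(μ.restrict {y : E3 | μ.map (fun x : E3 => x - y) ∈ D}) ≤ ENNReal.ofReal (250 / 6 * δ⁻¹ ^ 6)) := by
    rintro μ ⟨S, h0, hsep, rfl⟩
    have hb := lintegral_lennardJones_parts_map_sub_le hδ hsep h0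
    simp only [sub_zero, Measure.map_id'] at hb
    exact ⟨(lintegral_mono' Measure.restrict_le_self le_rfl).trans hb.1, (lintegral_mono' Measure.restrict_le_self le_rfl).trans hb.2⟩
  have hle1 : ∀ μ : Measure E3, Dᶜ.indicator (fun _ => (1 : ℝ≥0∞)) μ ≤ 1 := fun μ => by
    by_cases h : μ ∈ Dᶜ
    · rw [Set.indicator_of_mem h]
    · rw [Set.indicator_of_notMem h]; exact zero_le_one
  have hbp : ∫⁻ μ, ∫⁻ y, Fp μ y ∂μ ∂P ≠ ∞ := by
    refine lintegral_outflow_ne_top_of_bound (C := ENNReal.ofReal (250 / 12 * δ⁻¹ ^ 12)) ENNReal.ofReal_ne_top ?_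
    filter_upwards [hcore] with μ hμ
    simp only [hFp]
    rw [hout μ hμ _ hp]
    exact (mul_le_mul' (hle1 μ) (hbd μ hμ).1).trans_eq (one_mul _)
  have hbm : ∫⁻ μ, ∫⁻ y, Fm μ y ∂μ ∂P ≠ ∞ := by
    refine lintegral_outflow_ne_top_of_bound (C := ENNReal.ofReal (250 / 6 * δ⁻¹ ^ 6)) ENNReal.ofReal_ne_top ?_
    filter_upwards [hcore] with μ hμ
    simp only [hFm]
    rw [hout μ hμ _ hm]
    exact (mul_le_mul' (hle1 μ) (hbd μ hμ).2).trans_eq (one_mul _)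
  obtain ⟨-, -, hIop, hIip, heqp⟩ := integral_inflow_toReal_eq hδ hcore hstat hFpm hbp
  obtain ⟨-, -, hIom, hIim, heqm⟩ := integral_inflow_toReal_eq hδ hcore hstat hFmm hbm
  -- a.e. identifications
  have hout_ae : ∀ᵐ μ ∂P, (∫⁻ y, Fp μ y ∂μ).toReal - (∫⁻ y, Fm μ y ∂μ).toReal =
      Dᶜ.indicator (fun μ => ∫ z, lennardJones ‖z‖ ∂(μ.restrict {y : E3 | μ.map (fun x : E3 => x - y) ∈ D})) μ := by
    filter_upwards [hcore] with μ hμ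
    obtain ⟨hint1, -, -⟩ := rootEnergy_thin (D := D) hδ hμ (hT μ hμ).1
    simp only [hFp, hFm]
    rw [hout μ hμ _ hp, hout μ hμ _ hm]
    by_cases hμD : μ ∈ Dᶜ
    · simp only [Set.indicator_of_mem hμD, one_mul]
      rw [← integral_eq_lintegral_pos_part_sub_lintegral_neg_part hint1]
    · simp only [Set.indicator_of_notMem hμD, zero_mul, ENNReal.toReal_zero, sub_zero]
  have hin_ae : ∀ᵐ μ ∂P, (∫⁻ y, Fp (μ.map fun z => z - y) (-y) ∂μ).toReal - (∫⁻ y, Fm (μ.map fun z => z - y) (-y) ∂μ).toReal =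
      D.indicator (fun μ => ∫ z, lennardJones ‖z‖ ∂(μ.restrict {y : E3 | μ.map (fun x : E3 => x - y) ∈ D}ᶜ)) μ := by
    filter_upwards [hcore] with μ hμ
    obtain ⟨-, hint2, -⟩ := rootEnergy_thin (D := D) hδ hμ (hT μ hμ).1
    simp only [hFp, hFm]
    rw [hin μ hμ _ hp, hin μ hμ _ hm]
    simp only [norm_neg]
    by_cases hμD : μ ∈ D
    · simp only [Set.indicator_of_mem hμD, one_mul]
      rw [← integral_eq_lintegral_pos_part_sub_lintegral_neg_part hint2]
    · simp only [Set.indicator_of_notMem hμD, zero_mul, ENNReal.toReal_zero, sub_zero]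
  refine ⟨(hIop.sub hIom).congr hout_ae, (hIip.sub hIim).congr hin_ae, ?_⟩
  rw [← integral_indicator hD.compl, ← integral_indicator hD, ← integral_congr_ae hout_ae, ← integral_congr_ae hin_ae,
    integral_sub hIop hIom, integral_sub hIip hIim, heqp, heqm]

/-! ## §3. The binding price and the pointwise binding floor -/

/-- **BINDING PRICE OF A MINIMISING LAW** (Sütő's one-atom deletion test, law level, symmetrised).  Granted the floor of item 9229: for a
minimising point-stationary `δ`-hard-core probability law and every Giry-measurable deletion pattern `D`,
`∫_D (rootEnergy μ + ½ ∫ V_LJ(‖y‖) d(μ|{θ_y μ ∉ D})) dP ≤ P(D)·e⋆`. [folklore] -/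
theorem bindingPrice_of_minimising
    (hU : ∀ δ' : ℝ, 0 < δ' → ∀ Q : Measure (Measure E3), IsProbabilityMeasure Q → (∀ᵐ μ ∂Q, IsRootedHardCore δ' μ) →
      IsPointStationaryLaw Q → eStar ≤ ∫ μ, rootEnergy lennardJones μ ∂Q)
    (hδ : 0 < δ) [IsProbabilityMeasure P] (hcore : ∀ᵐ μ ∂P, IsRootedHardCore δ μ) (hstat : IsPointStationaryLaw P)
    (hD : MeasurableSet D) (hE : ∫ μ, rootEnergy lennardJones μ ∂P ≤ eStar) :
    Integrable (fun μ => ∫ z, lennardJones ‖z‖ ∂(μ.restrict {y : E3 | μ.map (fun x : E3 => x - y) ∈ D}ᶜ)) (P.restrict D) ∧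
    ∫ μ in D, (rootEnergy lennardJones μ + (∫ z, lennardJones ‖z‖ ∂(μ.restrict {y : E3 | μ.map (fun x : E3 => x - y) ∈ D}ᶜ)) / 2) ∂P ≤
      (P D).toReal * eStar := by
  -- thinning stability for the KEPT pattern `G = Dᶜ`
  have hthin := thinning_stability (G := Dᶜ) hU hδ hcore hstat hD.compl
  obtain ⟨hI1, hI2, hswap⟩ := integral_deletedField_eq hδ hcore hstat hD
  have hintE : Integrable (fun μ => rootEnergy lennardJones μ) P := integrable_rootEnergy_of_ae_hardCore hδ hcore
  -- the kept set of `Dᶜ` is the complement of the `D`-pattern atoms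
  have hK : ∀ μ : Measure E3, {u : E3 | μ.map (fun x : E3 => x - u) ∈ Dᶜ} = {y : E3 | μ.map (fun x : E3 => x - y) ∈ D}ᶜ := fun μ => rfl
  -- energy of the thinned configuration, on `Dᶜ`
  obtain ⟨T, -, hT⟩ := exists_measurable_thinning (G := D) hδ hD
  have hthin_ae : ∀ᵐ μ ∂(P.restrict Dᶜ), rootEnergy lennardJones (μ.restrict {u : E3 | μ.map (fun x : E3 => x - u) ∈ Dᶜ}) =
      rootEnergy lennardJones μ - (∫ z, lennardJones ‖z‖ ∂(μ.restrict {y : E3 | μ.map (fun x : E3 => x - y) ∈ D})) / 2 := by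
    filter_upwards [ae_restrict_of_ae (s := Dᶜ) hcore] with μ hμ
    rw [hK μ]
    exact (rootEnergy_thin (D := D) hδ hμ (hT μ hμ).1).2.2
  have hI1' : Integrable (fun μ => (∫ z, lennardJones ‖z‖ ∂(μ.restrict {y : E3 | μ.map (fun x : E3 => x - y) ∈ D})) / 2) (P.restrict Dᶜ) := by
    refine ((hI1.restrict (s := Dᶜ)).div_const 2).congr ?_
    filter_upwards [ae_restrict_mem hD.compl] with μ hμ
    simp only [Set.indicator_of_mem hμ]
  have hI2' : Integrable (fun μ => ∫ z, lennardJones ‖z‖ ∂(μ.restrict {y : E3 | μ.map (fun x : E3 => x - y) ∈ D}ᶜ)) (P.restrict D) := by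
    refine (hI2.restrict (s := D)).congr ?_
    filter_upwards [ae_restrict_mem hD] with μ hμ
    simp only [Set.indicator_of_mem hμ]
  refine ⟨hI2', ?_⟩
  rw [integral_congr_ae hthin_ae, integral_sub (hintE.restrict) hI1', integral_div, hswap] at hthin
  -- split `E[rootEnergy] = ∫_D + ∫_{Dᶜ}` and `1 = P(D) + P(Dᶜ)`
  have hsplit : ∫ μ in D, rootEnergy lennardJones μ ∂P + ∫ μ in Dᶜ, rootEnergy lennardJones μ ∂P = ∫ μ, rootEnergy lennardJones μ ∂P :=
    integral_add_compl hD hintE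
  have hmass : (P D).toReal + (P Dᶜ).toReal = 1 := by
    rw [← ENNReal.toReal_add (measure_ne_top P D) (measure_ne_top P Dᶜ), measure_add_measure_compl hD, measure_univ, ENNReal.toReal_one]
  have hm' : (P D).toReal * eStar + (P Dᶜ).toReal * eStar = eStar := by rw [← add_mul, hmass, one_mul]
  rw [integral_add (hintE.restrict) (hI2'.div_const 2), integral_div]
  linarith [hthin, hsplit, hm', hE]

/-- **THE POINTWISE BINDING FLOOR OF A MINIMISING LAW.**  Granted the floor of item 9229: for a minimising point-stationary `δ`-hard-core probability
law, almost surely `2·rootEnergy μ ≤ e⋆ + ½ ∫ V_LJ⁺(‖y‖) dμ` — the root's one-particle energy `Σ_{y≠0} V_LJ(‖y‖)` is at most `e⋆` up to half its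
short-range repulsion. [folklore] -/
theorem bindingFloor_of_minimising
    (hU : ∀ δ' : ℝ, 0 < δ' → ∀ Q : Measure (Measure E3), IsProbabilityMeasure Q → (∀ᵐ μ ∂Q, IsRootedHardCore δ' μ) →
      IsPointStationaryLaw Q → eStar ≤ ∫ μ, rootEnergy lennardJones μ ∂Q)
    (hδ : 0 < δ) [IsProbabilityMeasure P] (hcore : ∀ᵐ μ ∂P, IsRootedHardCore δ μ) (hstat : IsPointStationaryLaw P)
    (hE : ∫ μ, rootEnergy lennardJones μ ∂P ≤ eStar) :
    ∀ᵐ μ ∂P, 2 * rootEnergy lennardJones μ ≤ eStar + (∫ z, max (lennardJones ‖z‖) 0 ∂μ) / 2 := by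
  classical
  have hmax : ∀ x : ℝ, ENNReal.ofReal (max x 0) = ENNReal.ofReal x := fun x => by
    rcases le_total x 0 with h | h
    · rw [max_eq_right h, ENNReal.ofReal_zero, ENNReal.ofReal_of_nonpos h]
    · rw [max_eq_left h]
  obtain ⟨hp, hm⟩ := measurable_ofReal_lennardJones_parts
  have hLJm : Measurable fun y : E3 => lennardJones ‖y‖ := by
    have : Measurable lennardJones := by unfold lennardJones; fun_prop
    exact this.comp measurable_norm
  -- measurable versions of `2·rootEnergy` and of the repulsion
  set Ht : Measure E3 → ℝ := fun μ =>
    (∫⁻ z, ENNReal.ofReal (lennardJones ‖z‖) ∂μ).toReal - (∫⁻ z, ENNReal.ofReal (-lennardJones ‖z‖) ∂μ).toReal with hHt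
  set Rt : Measure E3 → ℝ := fun μ => (∫⁻ z, ENNReal.ofReal (lennardJones ‖z‖) ∂μ).toReal with hRt
  have hHtm : Measurable Ht := (Measure.measurable_lintegral hp).ennreal_toReal.sub (Measure.measurable_lintegral hm).ennreal_toReal
  have hRtm : Measurable Rt := (Measure.measurable_lintegral hp).ennreal_toReal
  have hident : ∀ μ : Measure E3, IsRootedHardCore δ μ →
      2 * rootEnergy lennardJones μ = Ht μ ∧ ∫ z, max (lennardJones ‖z‖) 0 ∂μ = Rt μ := fun μ hμ => by
    have hint := integrable_lennardJones_of_hardCore hδ hμ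
    refine ⟨?_, ?_⟩
    · rw [rootEnergy_def, integral_eq_lintegral_pos_part_sub_lintegral_neg_part hint]; ring
    · rw [integral_eq_lintegral_of_nonneg_ae (Filter.Eventually.of_forall fun z => (le_max_right _ _ : (0 : ℝ) ≤ max (lennardJones ‖z‖) 0))
        (show Measurable (fun z : E3 => max (lennardJones ‖z‖) 0) from hLJm.max measurable_const).aestronglyMeasurable]
      simp only [hRt, hmax]
  -- the deletion pattern: badly bound roots
  set D : Set (Measure E3) := {μ | eStar + Rt μ / 2 < Ht μ} with hDdef
  have hD : MeasurableSet D := measurableSet_lt (measurable_const.add (hRtm.div_const 2)) hHtm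
  obtain ⟨hI2, hprice⟩ := bindingPrice_of_minimising hU hδ hcore hstat hD hE
  obtain ⟨T, -, hT⟩ := exists_measurable_thinning (G := D) hδ hD
  -- on `D`: the integrand is `≥ 2 rootEnergy − ½ R > e⋆`... precisely `rootEnergy + ½ ∫_{kept} V ≥ (Ht − Rt/2)/... `
  have hptw : ∀ᵐ μ ∂(P.restrict D), eStar < rootEnergy lennardJones μ +
      (∫ z, lennardJones ‖z‖ ∂(μ.restrict {y : E3 | μ.map (fun x : E3 => x - y) ∈ D}ᶜ)) / 2 := by
    filter_upwards [ae_restrict_of_ae (s := D) hcore, ae_restrict_mem hD] with μ hμ hμD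
    obtain ⟨h1, h2⟩ := hident μ hμ
    obtain ⟨hintK, hintKc, hthin⟩ := rootEnergy_thin (D := D) hδ hμ (hT μ hμ).1
    have hint := integrable_lennardJones_of_hardCore hδ hμ
    -- `∫_{kept} V = 2 rootEnergy − ∫_{deleted} V ≥ 2 rootEnergy − R`
    have hdel : ∫ z, lennardJones ‖z‖ ∂(μ.restrict {y : E3 | μ.map (fun x : E3 => x - y) ∈ D}) ≤ ∫ z, max (lennardJones ‖z‖) 0 ∂μ :=
      calc ∫ z, lennardJones ‖z‖ ∂(μ.restrict {y : E3 | μ.map (fun x : E3 => x - y) ∈ D})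
          ≤ ∫ z, max (lennardJones ‖z‖) 0 ∂(μ.restrict {y : E3 | μ.map (fun x : E3 => x - y) ∈ D}) :=
            integral_mono hintK (hint.pos_part.mono_measure Measure.restrict_le_self) fun z => le_max_left _ _
        _ ≤ ∫ z, max (lennardJones ‖z‖) 0 ∂μ :=
            setIntegral_le_integral hint.pos_part (Filter.Eventually.of_forall fun z => le_max_right _ _)
    have hkept : ∫ z, lennardJones ‖z‖ ∂(μ.restrict {y : E3 | μ.map (fun x : E3 => x - y) ∈ D}ᶜ) =
        2 * rootEnergy lennardJones μ - ∫ z, lennardJones ‖z‖ ∂(μ.restrict {y : E3 | μ.map (fun x : E3 => x - y) ∈ D}) := by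
      rw [rootEnergy_def] at hthin ⊢
      rw [rootEnergy_def] at hthin
      linarith
    have hμD' : eStar + Rt μ / 2 < Ht μ := hμD
    rw [← h1, ← h2] at hμD'
    rw [hkept]
    linarith
  -- hence `P(D) = 0`
  have hPD : P D = 0 := by
    by_contra hne
    have hintE : Integrable (fun μ => rootEnergy lennardJones μ) P := integrable_rootEnergy_of_ae_hardCore hδ hcore
    have hintF : Integrable (fun μ => rootEnergy lennardJones μ +
        (∫ z, lennardJones ‖z‖ ∂(μ.restrict {y : E3 | μ.map (fun x : E3 => x - y) ∈ D}ᶜ)) / 2) (P.restrict D) :=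
      hintE.restrict.add (hI2.div_const 2)
    have h2 : ∫ _μ in D, eStar ∂P < ∫ μ in D, (rootEnergy lennardJones μ +
        (∫ z, lennardJones ‖z‖ ∂(μ.restrict {y : E3 | μ.map (fun x : E3 => x - y) ∈ D}ᶜ)) / 2) ∂P := by
      rw [← sub_pos, ← integral_sub hintF (integrable_const _)]
      refine (integral_pos_iff_support_of_nonneg_ae (μ := P.restrict D) (f := fun μ => (rootEnergy lennardJones μ +
        (∫ z, lennardJones ‖z‖ ∂(μ.restrict {y : E3 | μ.map (fun x : E3 => x - y) ∈ D}ᶜ)) / 2) - eStar) ?_ (hintF.sub (integrable_const _))).2 ?_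
      · filter_upwards [hptw] with μ h
        exact sub_nonneg.2 h.le
      · have hsupp : ∀ᵐ μ ∂(P.restrict D), μ ∈ Function.support fun μ => (rootEnergy lennardJones μ +
            (∫ z, lennardJones ‖z‖ ∂(μ.restrict {y : E3 | μ.map (fun x : E3 => x - y) ∈ D}ᶜ)) / 2) - eStar := by
          filter_upwards [hptw] with μ h
          rw [Function.mem_support]
          exact (sub_pos.2 h).ne'
        rw [ae_iff] at hsupp
        by_contra hle
        have h0 := le_antisymm (not_lt.1 hle) bot_le
        have : (P.restrict D) univ = 0 := by
          refine le_antisymm ?_ bot_le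
          calc (P.restrict D) univ ≤ (P.restrict D) (Function.support fun μ => (rootEnergy lennardJones μ +
                  (∫ z, lennardJones ‖z‖ ∂(μ.restrict {y : E3 | μ.map (fun x : E3 => x - y) ∈ D}ᶜ)) / 2) - eStar) +
                (P.restrict D) {μ | ¬μ ∈ Function.support fun μ => (rootEnergy lennardJones μ +
                  (∫ z, lennardJones ‖z‖ ∂(μ.restrict {y : E3 | μ.map (fun x : E3 => x - y) ∈ D}ᶜ)) / 2) - eStar} := by
                  rw [← Set.union_compl_self (Function.support fun μ => (rootEnergy lennardJones μ +
                    (∫ z, lennardJones ‖z‖ ∂(μ.restrict {y : E3 | μ.map (fun x : E3 => x - y) ∈ D}ᶜ)) / 2) - eStar)]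
                  exact measure_union_le _ _
            _ = 0 := by rw [h0, hsupp, add_zero]
        rw [Measure.restrict_apply_univ] at this
        exact hne this
    rw [setIntegral_const, smul_eq_mul] at h2
    have h3 : P.real D = (P D).toReal := rfl
    rw [h3] at h2
    linarith [hprice, h2]
  -- conclusion
  filter_upwards [hcore, measure_eq_zero_iff_ae_notMem.1 hPD] with μ hμ hμD
  obtain ⟨h1, h2⟩ := hident μ hμ
  rw [h1, h2]
  exact not_lt.1 hμD

/-- **THE BINDING FLOOR AT EVERY ATOM.**  Under the hypotheses of `bindingFloor_of_minimising`, almost surely EVERY atom `y` is bound by at least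
`|e⋆|` up to half its short-range repulsion: `2·rootEnergy(θ_y μ) ≤ e⋆ + ½ ∫ V_LJ⁺(‖z‖) d(θ_y μ)` (Aldous–Lyons transfer). [folklore] -/
theorem ae_forall_bindingFloor_of_minimising
    (hU : ∀ δ' : ℝ, 0 < δ' → ∀ Q : Measure (Measure E3), IsProbabilityMeasure Q → (∀ᵐ μ ∂Q, IsRootedHardCore δ' μ) →
      IsPointStationaryLaw Q → eStar ≤ ∫ μ, rootEnergy lennardJones μ ∂Q)
    (hδ : 0 < δ) [IsProbabilityMeasure P] (hcore : ∀ᵐ μ ∂P, IsRootedHardCore δ μ) (hstat : IsPointStationaryLaw P)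
    (hE : ∫ μ, rootEnergy lennardJones μ ∂P ≤ eStar) :
    ∀ᵐ μ ∂P, ∀ y : E3, μ {y} ≠ 0 →
      2 * rootEnergy lennardJones (μ.map fun z : E3 => z - y) ≤ eStar + (∫ z, max (lennardJones ‖z‖) 0 ∂(μ.map fun z : E3 => z - y)) / 2 :=
  hstat.ae_forall_map_sub (ae_shellFinite_of_hardCore hδ hcore) (bindingFloor_of_minimising hU hδ hcore hstat hE)

end Summit.AtomisticToContinuum.Crystallization.Theorems.FrustratedLawDichotomyBindingFloor

end
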